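import Summits.BirchSwinnertonDyer.BirchSwinnertonDyer.Theorems.GoldfeldAllTwistsTwoConverseTwinGenusDescentPartnerNegTwoExact
import Summits.BirchSwinnertonDyer.BirchSwinnertonDyer.Theorems.GoldfeldAllTwistsTwoConverseTwinGenusRankOne
import Summits.BirchSwinnertonDyer.BirchSwinnertonDyer.Theorems.Rank2ObservatoryTamagawaIzeroLocal
import Summits.BirchSwinnertonDyer.Rank1Residual.X12.O11.RouteUTraceForm
import Summits.BirchSwinnertonDyer.BirchSwinnertonDyer.Theorems.GoldfeldAllTwistsTwoConverseTwinAdditiveRootNumber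
import Literature.NumberTheory.EllipticCurves.QuadraticTwistPadicReduction
import Literature.NumberTheory.EllipticCurves.BSDInvariantsTamagawaProofs
import Literature.NumberTheory.QuadraticForms.PadicSquareCriteria
import HarnessLib

set_option linter.dupNamespace false -- `…BirchSwinnertonDyer.BirchSwinnertonDyer…` is the cell's namespace (D-0017)
set_option autoImplicit false

/-!
# LINE B49 — THEOREM B, local input (B1a): the Tamagawa numbers of `49a1^{(−q)}` at the ODD places,
# generic in the prime `q`, part 1 — the global minimal model `[0, 3q, 0, −32q², 64q³]`, the square-class lemma, `c₇ = 2`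

Cell `bsd-goldfeld`, seat `bsd-goldfeld-s1p-c301` (prover, gen 8); planner ruling g19 (liii), scope memo
`HOME/GENUS-THEOREM-B.md` factors F8/F9 (`|u| = 1`, `c_W = c₂·c₇·c_q = 16`). Support for item
`stmt-BirchSwinnertonDyer-19140` (twin″); Theses-free; theorems only. HONEST FRAMING: local arithmetic of an
explicit family of Weierstrass models; nothing about `L`-values or BSD.

Throughout `q` is a prime with `q ≡ 1 (mod 4)` and `(q/7) = −1` (inert in `ℚ(√−7)`), and
`V_q = X₀(49)^{(−4q)} = cm7.quadraticTwist (−4q) = [0, 3q, 0, −32q², 64q³]` (the tree's twist model at the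
discriminant `d_K = −4q` of `K = ℚ(√−q)`; every model `W = Cd • X₀(49)^{(d_K)}` of seat c301's
`X049BirchLemmaEvenDiscr` is `ℚ`-isomorphic to it, and `Tam` is a `ℚ`-isomorphism invariant,
`tamagawaProduct_variableChange_eq`). WHAT IS PROVED:
* §0 `V_q` is the base change of the integer model `[0, 3q, 0, −32q², 64q³]`, with `c₄ = 2⁴·105·q²`,
  `c₆ = 64·(−1323 q³)`, `Δ = −2¹²·7³·q⁶`; it is GLOBALLY MINIMAL (`isGloballyMinimal_twistModel`: file III's
  Kraus-at-`2` test — `2⁸ ∤ c₄`, `−1323q³ + 1 ≡ 2 (mod 4)` as `q ≡ 1 (mod 4)` — and `p¹² ∤ Δ` at odd `p`,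
  using `q ≠ 7`).
* §1 **twisting by a `p`-adic square class does not change `c_p`**
  (`localTamagawaNumber_padic_quadraticTwist_eq_of_sq`: `d = c·θ²` in `ℚ_p` ⇒ `E^{(d)} ⊗ ℚ_p ≅ E^{(c)} ⊗ ℚ_p`
  by `map_quadraticTwist` / `quadraticTwist_quadraticTwist` / `exists_variableChange_smul_eq_quadraticTwist_sq`,
  and `localTamagawaNumber_variableChange_holds`).
* §2 **`c₇(V_q) = 2`**: the Step-2 certificate `⟨7, 2, 0, −1, 3, 3, 2⟩` of `X₀(49) = [1,−1,0,−2,−1]` at `7`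
  (translate `(1, 2, 0, −1)` to `[1, 5, 0, 7, 0]`: `7 ∣ a₃, a₄, a₆, b₂ = 21`, `7³ ∥ Δ = −343`, `7² ∥ b₈ = −49`)
  gives Kodaira type `III` and `c₇(X₀(49)) = 2`; `−4q` is a `7`-adic unit square (`(−4q/7) = (−1/7)(q/7) = 1`,
  Serre II.3.3 Thm 3 = tree `padicInt_isSquare_unit_iff_toZMod`), so `V_q ≅ X₀(49)^{(1)} ≅ X₀(49)` over `ℚ₇`.
The places `q` (`c_q = 2`, the `I₀*` exact count) and `2` (`c₂ = 4`) and the assembly `Tam = 16` are the sibling file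
`…TwinBirchLocalTwo`.
References: [Silverman1994] IV.9.4 Steps 2–6 and Table 4.1; [Tate1975] §7; [SilvermanAEC2009] VII.1, VII.6, X.5
Cor. 5.4; [Serre1973] II.3.3; [Kraus1989] Prop. 2; [CremonaAlgorithms1997] Table 1 (N = 49: `c₇ = 2`).
-/

noncomputable section

open scoped Classical NumberField

open WeierstrassCurve IsDedekindDomain IsLocalRing Rat.HeightOneSpectrum
  Literature.NumberTheory.EllipticCurves Literature.NumberTheory.EllipticCurves.ModularForms
  Literature.NumberTheory.QuadraticForms
  Summit.BirchSwinnertonDyer.BirchSwinnertonDyer.Rank2Observatory.Tate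
  Summit.BirchSwinnertonDyer.BirchSwinnertonDyer.Rank2Observatory.RootNumber

namespace Summit.BirchSwinnertonDyer.BirchSwinnertonDyer.Theorems.GoldfeldGoodTwists

/-! ## §0 The integer model `[0, 3q, 0, −32q², 64q³]` of `X₀(49)^{(−4q)}` and its global minimality -/

section Model

variable (q : ℕ)

/-- `[0, 3q, 0, −32q², 64q³] ⊗ ℚ = X₀(49)^{(−4q)}` (`b₂(cm7) = −3`, `b₄ = −4`, `b₆ = −4`). [cite: SilvermanAEC2009, X.5 Cor. 5.4] -/
theorem twistModel_baseChange :
    (⟨0, 3 * q, 0, -32 * q ^ 2, 64 * q ^ 3⟩ : WeierstrassCurve ℤ).baseChange ℚ =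
      cm7.quadraticTwist ((-(4 * q) : ℤ) : ℚ) := by
  ext <;> simp [baseChange, quadraticTwist, b₂, b₄, b₆] <;> ring

/-- `c₄ = 1680 q² = 2⁴·105·q²`. [folklore] -/
theorem twistModel_c₄ : (⟨0, 3 * q, 0, -32 * q ^ 2, 64 * q ^ 3⟩ : WeierstrassCurve ℤ).c₄ = 1680 * q ^ 2 := by
  simp [WeierstrassCurve.c₄, b₂, b₄]; ring

/-- `c₆ = −84672 q³ = 64·(−1323 q³)`. [folklore] -/
theorem twistModel_c₆ :
    (⟨0, 3 * q, 0, -32 * q ^ 2, 64 * q ^ 3⟩ : WeierstrassCurve ℤ).c₆ = 64 * (-1323 * q ^ 3) := by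
  simp [WeierstrassCurve.c₆, b₂, b₄, b₆]; ring

/-- `Δ = −2¹²·7³·q⁶`. [folklore] -/
theorem twistModel_Δ :
    (⟨0, 3 * q, 0, -32 * q ^ 2, 64 * q ^ 3⟩ : WeierstrassCurve ℤ).Δ = -(2 ^ 12 * 7 ^ 3 * q ^ 6) := by
  simp [WeierstrassCurve.Δ, b₂, b₄, b₆, b₈]; ring

variable {q}

/-- A prime dividing `Δ = −2¹²7³q⁶` is `2`, `7` or `q`. [folklore] -/
theorem eq_of_prime_dvd_twistModel_Δ (hq : q.Prime) {p : ℕ} (hp : p.Prime)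
    (h : (p : ℤ) ∣ (⟨0, 3 * q, 0, -32 * q ^ 2, 64 * q ^ 3⟩ : WeierstrassCurve ℤ).Δ) :
    p = 2 ∨ p = 7 ∨ p = q := by
  rw [twistModel_Δ, dvd_neg] at h
  have h' : p ∣ 2 ^ 12 * 7 ^ 3 * q ^ 6 := by exact_mod_cast h
  rcases (Nat.Prime.dvd_mul hp).mp h' with h1 | h1
  · rcases (Nat.Prime.dvd_mul hp).mp h1 with h2 | h2
    · exact Or.inl ((Nat.prime_dvd_prime_iff_eq hp Nat.prime_two).mp (hp.dvd_of_dvd_pow h2))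
    · exact Or.inr (Or.inl ((Nat.prime_dvd_prime_iff_eq hp (by norm_num)).mp (hp.dvd_of_dvd_pow h2)))
  · exact Or.inr (Or.inr ((Nat.prime_dvd_prime_iff_eq hp hq).mp (hp.dvd_of_dvd_pow h1)))

/-- **`V_q = [0, 3q, 0, −32q², 64q³]` is a global minimal model of `49a1^{(−q)}`** for a prime `q ≡ 1 (mod 4)`,
`q ≠ 7`: Kraus at `2` (`2⁸ ∤ 2⁴·105·q²`; `c₆/64 + 1 = 1 − 1323q³ ≡ 2 (mod 4)`) and `p¹² ∤ 2¹²7³q⁶` for odd `p`.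
[cite: Kraus1989, Prop. 2] [cite: SilvermanAEC2009, VII.1 Remark 1.1] -/
theorem isGloballyMinimal_twistModel (hq : q.Prime) (hq4 : q % 4 = 1) (hq7 : q ≠ 7) :
    ((⟨0, 3 * q, 0, -32 * q ^ 2, 64 * q ^ 3⟩ : WeierstrassCurve ℤ).baseChange ℚ).IsGloballyMinimal := by
  have hq2 : q % 2 = 1 := by omega
  have hqodd : Odd (q : ℤ) := by exact_mod_cast Nat.odd_iff.mpr hq2
  refine isGloballyMinimal_baseChange_int_of_kraus _ (d := -1323 * q ^ 3) ?_ (twistModel_c₆ q) ?_ ?_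
  · -- `2⁸ ∤ 1680 q²`
    rw [twistModel_c₄]
    intro h
    have h16 : (2 : ℤ) ^ 8 = 16 * 16 := by norm_num
    rw [h16, show (1680 : ℤ) * q ^ 2 = 16 * (105 * q ^ 2) by ring] at h
    have h2 : (16 : ℤ) ∣ 105 * q ^ 2 := (mul_dvd_mul_iff_left (by norm_num)).mp h
    have hodd : Odd ((105 : ℤ) * q ^ 2) := (by decide : Odd (105 : ℤ)).mul (hqodd.pow)
    exact (Int.not_even_iff_odd.mpr hodd) (even_iff_two_dvd.mpr (dvd_trans ⟨8, by norm_num⟩ h2))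
  · -- `4 ∤ −1323 q³ + 1`
    intro h
    norm_num at h
    have hq1 : (q : ℤ) % 4 = 1 := by exact_mod_cast hq4
    have ht : ((q : ℤ) ^ 3) % 4 = 1 := by
      rw [show (q : ℤ) ^ 3 = q * (q * q) by ring, Int.mul_emod, Int.mul_emod (q : ℤ) q, hq1]
      norm_num
    omega
  · -- odd primes: `p¹² ∤ 2¹²·7³·q⁶`
    intro p hp hp2 h
    rw [twistModel_Δ, dvd_neg] at h
    have h' : p ^ 12 ∣ 2 ^ 12 * 7 ^ 3 * q ^ 6 := by exact_mod_cast h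
    have hcop2 : Nat.Coprime (p ^ 12) (2 ^ 12) :=
      Nat.Coprime.pow _ _ ((Nat.coprime_primes hp Nat.prime_two).mpr hp2)
    rw [mul_assoc] at h'
    have h'' : p ^ 12 ∣ 7 ^ 3 * q ^ 6 := hcop2.dvd_of_dvd_mul_left h'
    by_cases hp7 : p = 7
    · subst hp7
      have hcop : Nat.Coprime (7 ^ 9) (q ^ 6) :=
        Nat.Coprime.pow _ _ ((Nat.coprime_primes (by norm_num) hq).mpr (Ne.symm hq7))
      have h3 : 7 ^ 3 * 7 ^ 9 ∣ 7 ^ 3 * q ^ 6 := by rw [← pow_add]; exact h''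
      have h4 : 7 ^ 9 ∣ q ^ 6 := (Nat.mul_dvd_mul_iff_left (by norm_num)).mp h3
      have h5 := Nat.Coprime.eq_one_of_dvd hcop h4
      norm_num at h5
    · have hcop7 : Nat.Coprime (p ^ 12) (7 ^ 3) :=
        Nat.Coprime.pow _ _ ((Nat.coprime_primes hp (by norm_num)).mpr hp7)
      have h3 : p ^ 12 ∣ q ^ 6 := hcop7.dvd_of_dvd_mul_left h''
      have hpq : p ∣ q := hp.dvd_of_dvd_pow (dvd_trans (dvd_pow_self p (by norm_num)) h3)
      have hpq' : p = q := (Nat.prime_dvd_prime_iff_eq hp hq).mp hpq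
      subst hpq'
      have h4 := (Nat.pow_dvd_pow_iff_le_right hp.one_lt).mp h3
      omega

end Model

/-! ## §1 Twisting by a `p`-adic square class does not change the local Tamagawa number -/

section SquareClass

variable {p : ℕ} [Fact p.Prime]

/-- **`c_p(E^{(d)}) = c_p(E^{(c)})` when `d/c` is a square in `ℚ_p`**: `E^{(d)} ⊗ ℚ_p = ((E ⊗ ℚ_p)^{(c)})^{(θ²)}`
(`map_quadraticTwist`, `quadraticTwist_quadraticTwist`) is `ℚ_p`-isomorphic to `(E ⊗ ℚ_p)^{(c)} = E^{(c)} ⊗ ℚ_p`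
(`exists_variableChange_smul_eq_quadraticTwist_sq`), and the local Tamagawa number is an isomorphism invariant
(`localTamagawaNumber_variableChange_holds`). [cite: SilvermanAEC2009, X.5 Cor. 5.4 and VII.6] -/
theorem localTamagawaNumber_padic_quadraticTwist_eq_of_sq (E : WeierstrassCurve ℚ) [E.IsElliptic]
    {c d : ℚ} (hc : c ≠ 0) (hd : d ≠ 0) {θ : ℚ_[p]} (hθ : θ ≠ 0) (h : (d : ℚ_[p]) = c * θ ^ 2) :
    (haveI := E.isElliptic_quadraticTwist hd
     ((E.quadraticTwist d).baseChange ℚ_[p]).localTamagawaNumber ℤ_[p]) =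
      (haveI := E.isElliptic_quadraticTwist hc
       ((E.quadraticTwist c).baseChange ℚ_[p]).localTamagawaNumber ℤ_[p]) := by
  haveI := E.isElliptic_quadraticTwist hd
  haveI := E.isElliptic_quadraticTwist hc
  haveI : ((E.quadraticTwist c).baseChange ℚ_[p]).IsElliptic := by
    unfold WeierstrassCurve.baseChange; infer_instance
  have e1 : (E.quadraticTwist d).baseChange ℚ_[p] =
      ((E.baseChange ℚ_[p]).quadraticTwist (c : ℚ_[p])).quadraticTwist (θ ^ 2) := by
    rw [quadraticTwist_quadraticTwist, ← h, WeierstrassCurve.baseChange, map_quadraticTwist, eq_ratCast]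
    rfl
  have e2 : (E.quadraticTwist c).baseChange ℚ_[p] = (E.baseChange ℚ_[p]).quadraticTwist (c : ℚ_[p]) := by
    rw [WeierstrassCurve.baseChange, map_quadraticTwist, eq_ratCast]
    rfl
  obtain ⟨C, hC⟩ := ((E.baseChange ℚ_[p]).quadraticTwist (c : ℚ_[p])).exists_variableChange_smul_eq_quadraticTwist_sq hθ
  rw [e1, ← hC, ← e2]
  exact WeierstrassCurve.localTamagawaNumber_variableChange_holds ℤ_[p] ((E.quadraticTwist c).baseChange ℚ_[p]) C

end SquareClass

/-! ## §2 The place `7`: `c₇(X₀(49)) = 2` (type `III`) and `c₇(V_q) = 2` -/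

section Seven

/-- The Step-2 certificate of `X₀(49)` at `7` passes: translating by `(1, 2, 0, −1)` gives `[1, 5, 0, 7, 0]` with
`7 ∣ a₃, a₄, a₆, b₂ = 21`, `7³ ∥ Δ = −343`, exit at Step 4 (`7² ∣ a₆ = 0`, `7² ∥ b₈ = −49`).
[cite: Silverman1994, IV.9.4 Steps 1–4] -/
theorem step2Cert_check_cm7_seven : Step2Cert.check ⟨7, 2, 0, -1, 3, 3, 2⟩ ⟨1, -1, 0, -2, -1⟩ = true := by
  decide +kernel

/-- **`X₀(49)` has Kodaira type `III` and `ord Δ_min = 3` at the place above `7`.** [cite: Silverman1994, IV.9.4 Step 4]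
[cite: CremonaAlgorithms1997, Table 1 (N = 49)] -/
theorem kodairaSymbolAt_cm7_seven (v : HeightOneSpectrum (𝓞 ℚ)) (hv : natGenerator v = 7) :
    cm7.kodairaSymbolAt v = .III ∧ cm7.ordMinimalDiscriminant v = 3 := by
  have h := Step2Cert.sound (W₀ := ⟨1, -1, 0, -2, -1⟩) (c := ⟨7, 2, 0, -1, 3, 3, 2⟩) v hv step2Cert_check_cm7_seven
  rw [← cm7_eq_baseChange_int49a1] at h
  exact h

/-- **`c₇(X₀(49)) = 2`** at the place above `7` (type `III`). [cite: Silverman1994, IV.9.4 Step 4]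
[cite: CremonaAlgorithms1997, Table 1 (N = 49)] -/
theorem localTamagawaNumber_cm7_seven (v : HeightOneSpectrum (𝓞 ℚ)) (hv : natGenerator v = 7) :
    (cm7.baseChange (v.adicCompletion ℚ)).localTamagawaNumber (v.adicCompletionIntegers ℚ) = 2 := by
  haveI := perfectField_residueField_adicCompletionIntegers (K := ℚ) v
  exact localTamagawaNumber_eq_two_of_kodairaSymbolAt_eq_III_holds v _ (kodairaSymbolAt_cm7_seven v hv).1

/-- **`c₇(X₀(49)) = 2`** in Mathlib's `7`-adic numbers (`localTamagawaNumber_padic_eq_holds`).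
[cite: CremonaAlgorithms1997, Table 1 (N = 49)] -/
theorem localTamagawaNumber_padic_cm7_seven :
    (haveI : Fact (Nat.Prime 7) := ⟨by norm_num⟩
     (cm7.baseChange ℚ_[7]).localTamagawaNumber ℤ_[7]) = 2 := by
  haveI : Fact (Nat.Prime 7) := ⟨by norm_num⟩
  set w : HeightOneSpectrum (𝓞 ℚ) := (primesEquiv (R := 𝓞 ℚ)).symm ⟨7, by norm_num⟩ with hw
  have hw7 : (primesEquiv w : ℕ) = 7 := by rw [hw, Equiv.apply_symm_apply]
  have hgen : natGenerator w = 7 := by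
    rw [hw]; exact Literature.NumberTheory.GaloisRepresentations.Rat.natGenerator_primesEquiv_symm ⟨7, _⟩
  rw [localTamagawaNumber_padic_eq_holds cm7 w 7 hw7]
  exact localTamagawaNumber_cm7_seven w hgen

/-- `(−4q/7) = +1` for `(q/7) = −1`: `−4q` is a square unit in `ℤ₇`, so `−4q = 1 · θ²` in `ℚ₇` with `θ ≠ 0`.
[cite: Serre1973, Ch. II §3.3 Thm 3] -/
theorem exists_sq_eq_neg_four_mul_padic_seven {q : ℕ} (hq : q.Prime) (hq7 : jacobiSym q 7 = -1) :
    haveI : Fact (Nat.Prime 7) := ⟨by norm_num⟩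
    ∃ θ : ℚ_[7], θ ≠ 0 ∧ ((((-(4 * q) : ℤ)) : ℚ) : ℚ_[7]) = (1 : ℚ) * θ ^ 2 := by
  haveI : Fact (Nat.Prime 7) := ⟨by norm_num⟩
  obtain ⟨hq2, hq7'⟩ := ne_two_and_ne_seven_of_jacobiSym hq7
  -- `−4q` is a `7`-adic unit
  have hndvd : ¬ (7 : ℤ) ∣ (-(4 * q) : ℤ) := by
    rw [dvd_neg]
    intro h
    have h' : 7 ∣ 4 * q := by exact_mod_cast h
    rcases (Nat.Prime.dvd_mul (by norm_num)).mp h' with h4 | h4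
    · norm_num at h4
    · exact hq7' ((Nat.prime_dvd_prime_iff_eq (by norm_num) hq).mp h4).symm
  have hU : IsUnit (((-(4 * q) : ℤ)) : ℤ_[7]) := by
    rw [PadicInt.isUnit_iff]
    have hle := PadicInt.norm_le_one (((-(4 * q) : ℤ)) : ℤ_[7])
    have hlt : ¬ ‖(((-(4 * q) : ℤ)) : ℤ_[7])‖ < 1 := fun h =>
      hndvd ((PadicInt.norm_int_lt_one_iff_dvd _).mp (by exact_mod_cast h))
    exact le_antisymm hle (not_lt.mp hlt)
  -- its residue is a square: `legendreSym 7 (−4q) = (−1/7)(4/7)(q/7) = (−1)(1)(−1) = 1`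
  have hq0 : ((q : ℤ) : ZMod 7) ≠ 0 := by
    rw [Int.cast_natCast, Ne, ZMod.natCast_eq_zero_iff]
    exact fun h => hq7' ((Nat.prime_dvd_prime_iff_eq (by norm_num) hq).mp h).symm
  have h2z : ((2 : ℤ) : ZMod 7) ≠ 0 := fun h => by
    have h' := (ZMod.intCast_zmod_eq_zero_iff_dvd 2 7).mp h
    omega
  have hleg : legendreSym 7 (-(4 * q) : ℤ) = 1 := by
    rw [show (-(4 * q) : ℤ) = -1 * (2 ^ 2 * q) by ring, legendreSym.mul, legendreSym.mul,
      legendreSym.at_neg_one (by norm_num), ZMod.χ₄_nat_three_mod_four (by norm_num),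
      legendreSym.sq_one' 7 h2z, jacobiSym.legendreSym.to_jacobiSym, hq7]
    norm_num
  have hres0 : (((-(4 * q) : ℤ)) : ZMod 7) ≠ 0 := by
    intro h
    have h' : ((7 : ℕ) : ℤ) ∣ (-(4 * q) : ℤ) := (ZMod.intCast_zmod_eq_zero_iff_dvd _ 7).mp h
    exact hndvd (by exact_mod_cast h')
  have hsqZ : IsSquare ((((-(4 * q) : ℤ)) : ZMod 7)) := (legendreSym.eq_one_iff 7 hres0).mp hleg
  have hsq : IsSquare (((-(4 * q) : ℤ)) : ℤ_[7]) := by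
    have h := (padicInt_isSquare_unit_iff_toZMod (p := 7) (by norm_num) hU.unit).mpr (by
      rw [IsUnit.unit_spec, map_intCast]; exact hsqZ)
    rwa [IsUnit.unit_spec] at h
  obtain ⟨s, hs⟩ := hsq
  refine ⟨(s : ℚ_[7]), ?_, ?_⟩
  · intro hs0
    rw [PadicInt.coe_eq_zero] at hs0
    rw [hs0, mul_zero] at hs
    exact hU.ne_zero hs
  · rw [Rat.cast_one, one_mul, sq, ← PadicInt.coe_mul, ← hs, PadicInt.coe_intCast]
    push_cast
    ring

/-- **`c₇(V_q) = 2`** for `V_q = X₀(49)^{(−4q)}`, `q` prime with `(q/7) = −1`: over `ℚ₇`, `V_q ≅ X₀(49)^{(1)} ≅ X₀(49)`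
(§1 with `−4q = 1·θ²`; `completeSquare_smul_cm7`), and `c₇(X₀(49)) = 2`.
[cite: SilvermanAEC2009, X.5 Cor. 5.4 and VII.6] [cite: CremonaAlgorithms1997, Table 1 (N = 49)] -/
theorem localTamagawaNumber_padic_twist_seven {q : ℕ} (hq : q.Prime) (hq7 : jacobiSym q 7 = -1) :
    (haveI : Fact (Nat.Prime 7) := ⟨by norm_num⟩
     haveI := cm7.isElliptic_quadraticTwist (show (((-(4 * q) : ℤ)) : ℚ) ≠ 0 by
       have := hq.pos; exact_mod_cast (show (-(4 * (q : ℤ))) ≠ 0 by omega))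
     ((cm7.quadraticTwist (((-(4 * q) : ℤ)) : ℚ)).baseChange ℚ_[7]).localTamagawaNumber ℤ_[7]) = 2 := by
  haveI : Fact (Nat.Prime 7) := ⟨by norm_num⟩
  have hd : (((-(4 * q) : ℤ)) : ℚ) ≠ 0 := by
    have := hq.pos; exact_mod_cast (show (-(4 * (q : ℤ))) ≠ 0 by omega)
  obtain ⟨θ, hθ, h⟩ := exists_sq_eq_neg_four_mul_padic_seven hq hq7
  rw [localTamagawaNumber_padic_quadraticTwist_eq_of_sq cm7 one_ne_zero hd hθ h]
  -- `X₀(49)^{(1)} = C • X₀(49)` over `ℚ`, hence over `ℚ₇`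
  haveI := cm7.isElliptic_quadraticTwist (one_ne_zero (α := ℚ))
  have e : (cm7.quadraticTwist 1).baseChange ℚ_[7] =
      ((⟨1, 0, -(1 / 2 : ℚ), 0⟩ : VariableChange ℚ).map (algebraMap ℚ ℚ_[7])) • cm7.baseChange ℚ_[7] := by
    rw [← VariableChange.baseChange_smul_eq, completeSquare_smul_cm7]
  rw [e, WeierstrassCurve.localTamagawaNumber_variableChange_holds ℤ_[7] (cm7.baseChange ℚ_[7])]
  exact localTamagawaNumber_padic_cm7_seven

end Seven

end Summit.BirchSwinnertonDyer.BirchSwinnertonDyer.Theorems.GoldfeldGoodTwists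

end
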